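/-
Copyright (c) 2026 the pub-hodgecm-mathlib formalisation cell (harness21).  Prover seat hodgecm-mathlib-LH4-p08 (g2), req620 Track A «(D-RAM) FOUR-FRAME» squad, unit U3_Laws (iii),
MS ROAD STAGE B (Stage B lead LH4-p10 (g2), MS ledger LH4-p11 (g0); dealer LH4-plan (g11)): brick B5 (iv) «GLUED PARAMETER BOX COUNT» of `SPEC-StageB.v2-B5split.LH4p10g2.md`
(a6778cd80cb70dec) — THE CLAIM, assembled on the orbit–stabiliser route (LH4-p08 (g2) 2026-09-03T23:56Z).  2026-09-04.
-/
import Summits.HodgeConjecture.HodgeConjecture.Theorems.F0P3cDyRamDiagonalGluedTorusOrbits              -- ★ p855894 (iv-a) (this seat): orbit decomposition by the invariant `κ`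
import Summits.HodgeConjecture.HodgeConjecture.Theorems.F0P3cDyRamDiagonalGluedStabiliserIndexFull     -- (iv-b-idx) (this seat): `ncard_unitTorus_orbit_latt_glued_eq`
import Summits.HodgeConjecture.HodgeConjecture.Theorems.F0P3cDyRamDiagonalGluedClassRepresentatives    -- (iv-c) (this seat): `exists_fixed_class_representatives`
import Mathlib.Data.Set.Card.Arithmetic
import HarnessLib

/-!
# Crux `H413`, line LH4 «(D-RAM) FOUR-FRAME» road — unit U3_Laws (iii), MS ROAD STAGE B, brick B5 (iv) «GLUED PARAMETER BOX COUNT»: the number of DUALISABLE lattices in the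
# glued stratum `G₁(2ρ, 2t)` is `(q − 1)³ · q^{3ρ + ⌈ρ∕2⌉ + 2t − 3}`

Cell `hodgecm-mathlib` (D-0151), FLOOR 0, crux item H413 = `stmt-HodgeConjecture-24833`, route of record `HCCMUnconditional`; squad F0∕P3c∕LH4 (req620).  THEOREMS ONLY (no `def`,
no instance, no notation, no `sorry`, default heartbeats); lane `--supports stmt-HodgeConjecture-24833 --as helper` (count-neutral).  THE CLAIM of LH4-p10 (g2)'s SPEC v2-B5split
§B5(iv) (dealt to this seat 2026-09-03T23:43:59Z), γ-free: the dualisable part of the glued stratum `{latt V(x, ζ, y″) : |x| = |ζ| = 1, |y″| = |ϖ|^{2t}}`,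
`V(x, ζ, y″) = [[1,0,0],[x,ϖ^ρ,0],[xζ+y″, ϖ^ρ ζ, ϖ^{2ρ+2t}]]`, has `(q−1)³·q^{3ρ + (ρ+1)∕2 + 2t − 3}` lattices (`q = Nat.card 𝓀[K]`; B10 multiplies by B5 (iii)'s weight).

THE PROOF (orbit–stabiliser, instead of the sheet's twisted residue box — same number): by ★ (iv-a) the dualisable glued lattices are exactly the members of the unit-torus orbits
`𝒯·latt V(1, 1, g)` for `g` running over a system `R` of representatives of the `σ`-FIXED elements of valuation `|ϖ|^{2t}` modulo `𝔭^{ρ+2t}` (★ (iv-c): `#R = (q−1)·q^{⌈ρ∕2⌉−1}`):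
(⊆) a dualisable `latt V(x, ζ, y″)` has `κ = y″∕(xζ)` within `𝔭^{ρ+2t}` of a fixed `f` (★ (iv-a) §4), hence of some `g ∈ R` ((R2)), hence lies in `𝒯·latt V(1,1,g)` (★ (iv-a) §3);
(⊇) every member of `𝒯·latt V(1,1,g)` is glued with `κ = g` exactly (★ (iv-a) §3), so dualisable (★ (iv-a) §4 with `f := g`); the orbits are pairwise DISJOINT because `κ` mod
`𝔭^{ρ+2t}` is a lattice invariant (★ (iv-a) §2) and `R` is irredundant ((R3)); each orbit has `((q−1)q^{ρ+2t−1})·((q−1)q^{2ρ−1})` members (★ (iv-b-idx)).  Hence the count is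
`(q−1)q^{⌈ρ∕2⌉−1} · (q−1)²q^{3ρ+2t−2} = (q−1)³·q^{3ρ + (ρ+1)∕2 + 2t − 3}`.

* ONE HEAD **`ncard_dualisable_glued_eq`** — SPEC §B5(iv) CLAIM verbatim (binders `hσ hvσ hfix hϖ hd [Finite 𝓀[K]] hTr ρ t hρ ht`); inside it: (§1a) the set identity
  `S = ⋃_{g ∈ R} 𝒯·latt V₀(g)`, (§1b) `R.PairwiseDisjoint`, (§1c) the orbit size, then `Set.Finite.ncard_biUnion` + `finsum` of a constant and ℕ exponent bookkeeping.
HONEST LABEL.  Count-neutral; nothing printed is asserted; the census laws stay PROVER TARGETS; `HC_CM` is proved only modulo the 7 printed citations (2 remaining named inputs: hLiu418 =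
`stmt-HodgeConjecture-24832`, h413 = `stmt-HodgeConjecture-24833`) until rung 0 closes.

## References
* [Kottwitz1986BaseChangeUnits] R. Kottwitz, *Base change for unit elements of Hecke algebras*, Compositio Math. 60 (1986), §1 pp. 240–241 (lattice counts via torus orbits and
  diagonal stabilisers).
* [Serre1979] J.-P. Serre, *Local Fields*, GTM 67 (1979), Ch. IV §2 Prop. 6 (unit filtration counts).
-/

set_option autoImplicit false

noncomputable section

namespace Summit.HodgeConjecture.HodgeConjecture.Cruxes.H413.F0P3cDyRamDiagonalGluedBoxCount

open Matrix
open Literature.NumberTheory.Automorphic Literature.NumberTheory.Automorphic.HermitianLattice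
open Literature.NumberTheory.Automorphic.UnitaryLatticeTree
open Summit.HodgeConjecture.HodgeConjecture.Cruxes.H413.F0P3cDyRamDiagonalTorusDefs
open Summit.HodgeConjecture.HodgeConjecture.Cruxes.H413.F0P3cDyRamDiagonalGluedTorusOrbits
open Summit.HodgeConjecture.HodgeConjecture.Cruxes.H413.F0P3cDyRamDiagonalGluedStabiliserIndexFull
open Summit.HodgeConjecture.HodgeConjecture.Cruxes.H413.F0P3cDyRamDiagonalGluedClassRepresentatives
open scoped Valued WithZero Matrix MatrixGroups

variable {K : Type*} [Field K] [Valued K ℤᵐ⁰]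

/-! ## HEAD — the count -/

/-- **B5 (iv) «GLUED PARAMETER BOX COUNT» (SPEC v2-B5split §B5(iv) CLAIM).**  For a ramified quadratic datum (`σ` involution with `v ∘ σ = v`, fixed elements of even valuation,
`|ϖ| = exp(−1)`, `|ϖ − σϖ| = |ϖ|^d`, finite residue field, the wild trace bound `|a + σa| ≤ |ϖ|·|a|`) and `ρ, t ≥ 1`: the DUALISABLE lattices of the glued stratum
`{latt [[1,0,0],[x,ϖ^ρ,0],[xζ+y″, ϖ^ρ ζ, ϖ^{2ρ+2t}]] : |x| = |ζ| = 1, |y″| = |ϖ|^{2t}}` number `(q − 1)³ · q^{3ρ + (ρ+1)∕2 + 2t − 3}`.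
[cite: Kottwitz1986BaseChangeUnits, §1 pp. 240–241] [cite: Serre1979, Ch. IV §2 Prop. 6] -/
theorem ncard_dualisable_glued_eq {σ : K →+* K} {ϖ : K} {d : ℕ} (hσ : ∀ x, σ (σ x) = x) (hvσ : ∀ a, Valued.v (σ a) = Valued.v a)
    (hfix : ∀ x : K, σ x = x → x ≠ 0 → ∃ n : ℤ, Valued.v x = WithZero.exp (2 * n)) (hϖ : Valued.v ϖ = WithZero.exp (-1 : ℤ))
    (hd : Valued.v (ϖ - σ ϖ) = Valued.v ϖ ^ d) [Finite 𝓀[K]] (hTr : ∀ a : K, Valued.v (a + σ a) ≤ Valued.v ϖ * Valued.v a)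
    (ρ t : ℕ) (hρ : 1 ≤ ρ) (ht : 1 ≤ t) :
    {M : Submodule 𝒪[K] (Fin 3 → K) | ∃ x ζ y'' : K, Valued.v x = 1 ∧ Valued.v ζ = 1 ∧ Valued.v y'' = Valued.v ϖ ^ (2 * t) ∧
        M = latt (!![1, 0, 0; x, ϖ ^ ρ, 0; x * ζ + y'', ϖ ^ ρ * ζ, ϖ ^ (2 * ρ + 2 * t)] : Matrix (Fin 3) (Fin 3) K) ∧ IsDualisableLattice σ ϖ M}.ncard =
      (Nat.card 𝓀[K] - 1) ^ 3 * Nat.card 𝓀[K] ^ (3 * ρ + (ρ + 1) / 2 + 2 * t - 3) := by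
  classical
  obtain ⟨hϖ0, hϖ1⟩ := F0P3cDyRamDiagonalGluedStabiliserIndex.ne_zero_and_v_lt_one_of_v_eq_exp hϖ
  have hpρ : ϖ ^ ρ ≠ 0 := pow_ne_zero ρ hϖ0
  have hpr : ϖ ^ (2 * ρ + 2 * t) ≠ 0 := pow_ne_zero _ hϖ0
  -- the representatives and the reference lattices `V₀(g) = V(1, 1, g)`
  obtain ⟨R, hRfin, hRcard, hR1, hR2, hR3⟩ := exists_fixed_class_representatives hσ hvσ hfix hϖ hd ρ t hρ
  choose V₀ hV₀ using fun g : K => exists_gl_coe_eq_glued (1 : K) 1 g hpρ hpr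
  -- the orbits
  set Orb : K → Set (Submodule 𝒪[K] (Fin 3 → K)) := fun g => {M | ∃ u ∈ unitTorus K 3, M = mapGL (diagGLUnits u) (latt (V₀ g : Matrix (Fin 3) (Fin 3) K))}
    with hOrb
  -- valuations of the representatives
  have hvg : ∀ g ∈ R, Valued.v g < 1 := fun g hg => by
    rw [(hR1 g hg).2]; exact pow_lt_one₀ zero_le hϖ1 (by omega)
  have hlt : Valued.v ϖ ^ (ρ + 2 * t) < Valued.v ϖ ^ (2 * t) := by
    rw [pow_add, mul_comm]
    exact mul_lt_of_lt_one_right (pow_pos ((Valuation.pos_iff _).2 hϖ0) _) (pow_lt_one₀ zero_le hϖ1 (by omega))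
  -- §1a: the set identity
  have hset : {M : Submodule 𝒪[K] (Fin 3 → K) | ∃ x ζ y'' : K, Valued.v x = 1 ∧ Valued.v ζ = 1 ∧ Valued.v y'' = Valued.v ϖ ^ (2 * t) ∧
        M = latt (!![1, 0, 0; x, ϖ ^ ρ, 0; x * ζ + y'', ϖ ^ ρ * ζ, ϖ ^ (2 * ρ + 2 * t)] : Matrix (Fin 3) (Fin 3) K) ∧ IsDualisableLattice σ ϖ M} =
      ⋃ g ∈ R, Orb g := by
    ext M
    simp only [Set.mem_setOf_eq, Set.mem_iUnion, hOrb]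
    constructor
    · rintro ⟨x, ζ, y'', hx, hζ, hy'', rfl, hdual⟩
      obtain ⟨V, hV⟩ := exists_gl_coe_eq_glued x ζ y'' hpρ hpr
      rw [← hV] at hdual
      obtain ⟨f, hσf, hκf⟩ := (isDualisableLattice_latt_glued_iff_exists_fixed_kappa hσ hvσ hϖ0 hϖ1 hTr ρ t hρ ht hx hζ hy'' V hV).1 hdual
      -- `|f| = |κ| = |ϖ|^{2t}`
      have hvκ : Valued.v (y'' / (x * ζ)) = Valued.v ϖ ^ (2 * t) := by rw [map_div₀, map_mul, hx, hζ, mul_one, div_one, hy'']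
      have hvf : Valued.v f = Valued.v ϖ ^ (2 * t) := by
        have h := Valuation.map_sub_eq_of_lt_left Valued.v (hvκ ▸ hκf.trans_lt hlt : Valued.v (y'' / (x * ζ) - f) < Valued.v (y'' / (x * ζ)))
        -- `f = κ − (κ − f)`
        rw [← hvκ, ← h, sub_sub_cancel]
      obtain ⟨g, hg, hfg⟩ := hR2 f hσf hvf
      have hκg : Valued.v (y'' / (x * ζ) - g) ≤ Valued.v ϖ ^ (ρ + 2 * t) := by
        rw [show y'' / (x * ζ) - g = (y'' / (x * ζ) - f) + (f - g) by ring]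
        exact Valuation.map_add_le _ hκf hfg
      obtain ⟨u, hu, hM⟩ := exists_mem_unitTorus_latt_glued_eq_mapGL hϖ0 ρ t hx hζ hy'' ht hϖ1 (hvg g hg) hκg (V₀ g) (hV₀ g)
      exact ⟨g, hg, u, hu, hM⟩
    · rintro ⟨g, hg, u, hu, rfl⟩
      obtain ⟨x', ζ', y₁, hx', hζ', hy₁, hκ, hM⟩ := exists_glued_of_mem_orbit u hu g (ϖ ^ ρ) (ϖ ^ (2 * ρ + 2 * t)) (V₀ g) (hV₀ g)
      have hy₁' : Valued.v y₁ = Valued.v ϖ ^ (2 * t) := by rw [hy₁, (hR1 g hg).2]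
      refine ⟨x', ζ', y₁, hx', hζ', hy₁', hM, ?_⟩
      obtain ⟨V, hV⟩ := exists_gl_coe_eq_glued x' ζ' y₁ hpρ hpr
      rw [hM, ← hV]
      exact (isDualisableLattice_latt_glued_iff_exists_fixed_kappa hσ hvσ hϖ0 hϖ1 hTr ρ t hρ ht hx' hζ' hy₁' V hV).2
        ⟨g, (hR1 g hg).1, by rw [hκ, sub_self, map_zero]; exact zero_le⟩
  -- §1b: pairwise disjoint
  have hdisj : R.PairwiseDisjoint Orb := by
    intro g hg g' hg' hne
    rw [Function.onFun, Set.disjoint_left]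
    intro M hM hM'
    apply hne
    simp only [hOrb, Set.mem_setOf_eq] at hM hM'
    obtain ⟨u, hu, rfl⟩ := hM
    obtain ⟨u', hu', hMM⟩ := hM'
    obtain ⟨x, ζ, y, hx, hζ, hy, hκ, h1⟩ := exists_glued_of_mem_orbit u hu g (ϖ ^ ρ) (ϖ ^ (2 * ρ + 2 * t)) (V₀ g) (hV₀ g)
    obtain ⟨x', ζ', y', hx', hζ', hy', hκ', h2⟩ := exists_glued_of_mem_orbit u' hu' g' (ϖ ^ ρ) (ϖ ^ (2 * ρ + 2 * t)) (V₀ g') (hV₀ g')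
    have hyv : Valued.v y = Valued.v ϖ ^ (2 * t) := by rw [hy, (hR1 g hg).2]
    have heq := h1.symm.trans (hMM.trans h2)
    have hv := v_kappa_sub_le_of_latt_glued_eq hϖ0 hϖ1.le ρ t hx hζ hyv hx' hζ' heq
    rw [hκ, hκ'] at hv
    exact hR3 g hg g' hg' hv
  -- §1c: each orbit has the stabiliser index as its size
  have horb : ∀ g ∈ R, (Orb g).ncard = ((Nat.card 𝓀[K] - 1) * Nat.card 𝓀[K] ^ (ρ + 2 * t - 1)) * ((Nat.card 𝓀[K] - 1) * Nat.card 𝓀[K] ^ (2 * ρ - 1)) := by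
    intro g hg
    have h11 : Valued.v (1 : K) = 1 := map_one _
    exact ncard_unitTorus_orbit_latt_glued_eq hϖ hρ (2 * t) h11 h11 (by rw [(hR1 g hg).2]) (V₀ g) (by rw [hV₀ g])
  -- count
  have hq : 1 < Nat.card 𝓀[K] := Finite.one_lt_card
  have hN0 : ((Nat.card 𝓀[K] - 1) * Nat.card 𝓀[K] ^ (ρ + 2 * t - 1)) * ((Nat.card 𝓀[K] - 1) * Nat.card 𝓀[K] ^ (2 * ρ - 1)) ≠ 0 :=
    mul_ne_zero (mul_ne_zero (by omega) (pow_ne_zero _ (by omega))) (mul_ne_zero (by omega) (pow_ne_zero _ (by omega)))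
  rw [hset, hRfin.ncard_biUnion (fun g hg => Set.finite_of_ncard_ne_zero (by rw [horb g hg]; exact hN0)) hdisj,
    finsum_mem_congr rfl horb, ← mul_one (((Nat.card 𝓀[K] - 1) * _) * _), ← mul_finsum_mem' _ _ hRfin, finsum_one, hRcard]
  -- exponent bookkeeping
  obtain ⟨m, hm⟩ : ∃ m, (ρ + 1) / 2 = m + 1 := ⟨(ρ + 1) / 2 - 1, by omega⟩
  rw [hm, Nat.add_sub_cancel, show 3 * ρ + (m + 1) + 2 * t - 3 = (ρ + 2 * t - 1) + (2 * ρ - 1) + m by omega]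
  ring

end Summit.HodgeConjecture.HodgeConjecture.Cruxes.H413.F0P3cDyRamDiagonalGluedBoxCount

end
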